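import Literature.Topology.FourManifolds.BandSumUnitPolarCoords
import HarnessLib

/-!
# The unknot is a unit for the connected sum — polar/inversion model, III: the two arcs

Topic `Literature/Topology/FourManifolds`; sequel of `BandSumUnitPolarCoords.lean` (seat-B line of the
discharge of `Literature.Topology.FourManifolds.Knot.exists_isConnectedSum_unknot_isIsotopic`,
Rolfsen (1976), §2.G). The planar arcs `lowerArc`, `upperArc` of the band-sum data
(`Literature.Topology.FourManifolds.BandData`, `BandSum.lean`) of `K # O` in band coordinates of the
polar rectangle, by explicit formulas:

* the constants: amplitude `Aamp = 1/(20 κ)` (so `κ A = 1/20`), slope `cc = A/(3/10)`;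
* the **height profile** `rho` (`t` up to `3/20`, a plateau `3/10` on `[3/10, 7/10]`, `1 - t` from
  `17/20` on, smooth and monotone in between via `phi t = t + S(t) (3/10 - t)`), `V = cc · rho`:
  affine of slope `±cc` near the ends, constant `A` in the middle, `0 < V ≤ A` on `(0, 1)`;
* the **radial profile** `X0 = smoothStep (1/4) (3/4)`, with `X0 (3/10) ≤ 1/40` and the symmetry
  `X0 (1 - t) = 1 - X0 t`;
* `upperArc t = (1 - X0 t, 11/10 - V t)` (from the corner `(1, 11/10)` to `(0, 11/10)` through the
  upper part of the collar square `squareNhd (1/10)`), `lowerArc t = (X0 t, -1/10 + V t)`, with all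
  clauses required by `BandData`: smooth, injective on `[0, 1]`, regular, end points, membership
  (`contDiff_*`, `injOn_*`, `deriv_*_ne_zero`, `*_zero`, `*_one`, `*_mem`).

The point of the three-phase design (first the height moves while the radius is still at the edge,
then the radius alone, then the height again) is that, read through the polar/inversion model, the
first model coordinate is monotone along the arcs (`BandSumUnitPolarWindow.lean`).

## References

* D. Rolfsen, *Knots and Links*, Publish or Perish (1976), §2.G (the consumer). [Rolfsen1976]

## Design notes

Everything is `[folklore]`; no named facts, no `sorry`.
-/

open scoped ContDiff Topology Real
open Function Set Real

noncomputable section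

namespace Literature.Topology.FourManifolds

namespace BandSumUnit

namespace Polar

/-! ### Constants -/

/-- `κ > 3`. [folklore] -/
theorem three_lt_kap : 3 < kap := by
  rw [kap, lt_div_iff₀ (by norm_num)]; linarith [pi_gt_three]

/-- `κ < 7/2`. [folklore] -/
theorem kap_lt : kap < 7 / 2 := by
  rw [kap, div_lt_iff₀ (by norm_num)]; linarith [pi_lt_d2]

/-- **The amplitude** `A = 1/(20 κ)` of the arcs in `x₁` (so that `κ A = 1/20`). [folklore] -/
def Aamp : ℝ := (20 * kap)⁻¹

/-- `κ A = 1/20`. [folklore] -/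
theorem kap_mul_Aamp : kap * Aamp = 1 / 20 := by
  rw [Aamp]; field_simp [kap_pos.ne']

/-- `A > 0`. [folklore] -/
theorem Aamp_pos : 0 < Aamp := by rw [Aamp]; have := kap_pos; positivity

/-- `A < 1/60`. [folklore] -/
theorem Aamp_lt : Aamp < 1 / 60 := by
  rw [Aamp, inv_lt_comm₀ (by have := kap_pos; positivity) (by norm_num)]
  linarith [three_lt_kap]

/-- **The slope** `c = A/(3/10)` of the affine ends of the arcs. [folklore] -/
def cc : ℝ := Aamp / (3 / 10)

/-- `c > 0`. [folklore] -/
theorem cc_pos : 0 < cc := by rw [cc]; exact div_pos Aamp_pos (by norm_num)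

/-- `c (3/10) = A`. [folklore] -/
theorem cc_mul : cc * (3 / 10) = Aamp := by rw [cc]; field_simp

/-- `c < 1/18`. [folklore] -/
theorem cc_lt : cc < 1 / 18 := by rw [cc]; linarith [Aamp_lt, Aamp_pos]

/-! ### The height profile of the arcs -/

/-- `φ t = t + S(t) (3/10 - t)` with `S` the smooth step from `3/20` to `3/10`: the identity up to
`3/20`, then bending to the constant `3/10` from `3/10` on, increasing. [folklore] -/
def phi (t : ℝ) : ℝ := t + smoothStep (3 / 20) (3 / 10) t * (3 / 10 - t)

/-- `φ t = t` for `t ≤ 3/20`. [folklore] -/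
theorem phi_of_le {t : ℝ} (ht : t ≤ 3 / 20) : phi t = t := by
  rw [phi, smoothStep_of_le (by norm_num) ht]; ring

/-- `φ t = 3/10` for `t ≥ 3/10`. [folklore] -/
theorem phi_of_ge {t : ℝ} (ht : 3 / 10 ≤ t) : phi t = 3 / 10 := by
  rw [phi, smoothStep_of_ge (by norm_num) ht]; ring

/-- `t ≤ φ t` for `t ≤ 3/10`. [folklore] -/
theorem le_phi {t : ℝ} (ht : t ≤ 3 / 10) : t ≤ phi t := by
  rw [phi]; nlinarith [(smoothStep_mem_Icc (3 / 20) (3 / 10) t).1]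

/-- `φ t ≤ 3/10`. [folklore] -/
theorem phi_le (t : ℝ) : phi t ≤ 3 / 10 := by
  rcases le_or_gt (3 / 10) t with h | h
  · rw [phi_of_ge h]
  · rw [phi]; nlinarith [(smoothStep_mem_Icc (3 / 20) (3 / 10) t).2]

/-- `φ` is `C^∞`. [folklore] -/
theorem contDiff_phi : ContDiff ℝ ∞ phi :=
  contDiff_id.add ((contDiff_smoothStep _ _).mul (contDiff_const.sub contDiff_id))

/-- The derivative of `φ`. [folklore] -/
theorem hasDerivAt_phi (t : ℝ) :
    HasDerivAt phi (1 + (deriv (smoothStep (3 / 20) (3 / 10)) t * (3 / 10 - t) -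
      smoothStep (3 / 20) (3 / 10) t)) t := by
  unfold phi
  have hS := (differentiable_smoothStep (3 / 20) (3 / 10) t).hasDerivAt
  have h1 : HasDerivAt (fun s : ℝ ↦ (3 / 10 : ℝ) - s) (0 - 1) t := (hasDerivAt_const t (3 / 10 : ℝ)).sub (hasDerivAt_id t)
  have h2 : HasDerivAt (fun s ↦ smoothStep (3 / 20) (3 / 10) s * ((3 / 10 : ℝ) - s))
      (deriv (smoothStep (3 / 20) (3 / 10)) t * ((3 / 10 : ℝ) - t) + smoothStep (3 / 20) (3 / 10) t * (0 - 1)) t :=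
    hS.fun_mul h1
  have h := (hasDerivAt_id t).fun_add h2
  refine h.congr_deriv ?_
  ring

/-- `φ' > 0` on `(-∞, 3/10)`. [folklore] -/
theorem deriv_phi_pos {t : ℝ} (ht : t < 3 / 10) : 0 < deriv phi t := by
  rw [(hasDerivAt_phi t).deriv]
  have h1 : smoothStep (3 / 20) (3 / 10) t < 1 := by
    rcases le_or_gt t (3 / 20) with h | h
    · rw [smoothStep_of_le (by norm_num) h]; norm_num
    · exact (smoothStep_mem_Ioo (by norm_num) ⟨h, ht⟩).2
  have h2 : 0 ≤ deriv (smoothStep (3 / 20) (3 / 10)) t := deriv_smoothStep_nonneg (by norm_num) t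
  nlinarith

/-- **The height profile** `ρ t = φ t + φ (1 - t) - 3/10`: `t` near `0`, the plateau `3/10` in the
middle, `1 - t` near `1`. [folklore] -/
def rho (t : ℝ) : ℝ := phi t + phi (1 - t) - 3 / 10

/-- `ρ t = φ t` for `t ≤ 7/10`. [folklore] -/
theorem rho_of_le {t : ℝ} (ht : t ≤ 7 / 10) : rho t = phi t := by
  rw [rho, phi_of_ge (t := 1 - t) (by linarith)]; ring

/-- `ρ t = φ (1 - t)` for `t ≥ 3/10`. [folklore] -/
theorem rho_of_ge {t : ℝ} (ht : 3 / 10 ≤ t) : rho t = phi (1 - t) := by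
  rw [rho, phi_of_ge ht]; ring

/-- `ρ t = t` for `t ≤ 3/20`. [folklore] -/
theorem rho_eq_self {t : ℝ} (ht : t ≤ 3 / 20) : rho t = t := by
  rw [rho_of_le (by linarith), phi_of_le ht]

/-- `ρ t = 1 - t` for `t ≥ 17/20`. [folklore] -/
theorem rho_eq_one_sub {t : ℝ} (ht : 17 / 20 ≤ t) : rho t = 1 - t := by
  rw [rho_of_ge (by linarith), phi_of_le (by linarith)]

/-- `ρ t = 3/10` on the plateau `[3/10, 7/10]`. [folklore] -/
theorem rho_eq_plateau {t : ℝ} (h1 : 3 / 10 ≤ t) (h2 : t ≤ 7 / 10) : rho t = 3 / 10 := by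
  rw [rho_of_le h2, phi_of_ge h1]

/-- `ρ ≤ 3/10`. [folklore] -/
theorem rho_le (t : ℝ) : rho t ≤ 3 / 10 := by
  rw [rho]; linarith [phi_le t, phi_le (1 - t)]

/-- `0 < ρ t` for `t ∈ (0, 1)`. [folklore] -/
theorem rho_pos {t : ℝ} (h0 : 0 < t) (h1 : t < 1) : 0 < rho t := by
  rcases le_or_gt t (7 / 10) with h | h
  · rw [rho_of_le h]
    rcases le_or_gt t (3 / 10) with h' | h'
    · linarith [le_phi h']
    · rw [phi_of_ge h'.le]; norm_num
  · rw [rho_of_ge (by linarith)]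
    linarith [le_phi (t := 1 - t) (by linarith)]

/-- `ρ 0 = 0`. [folklore] -/
@[simp] theorem rho_zero : rho 0 = 0 := by rw [rho_eq_self (by norm_num)]

/-- `ρ 1 = 0`. [folklore] -/
@[simp] theorem rho_one : rho 1 = 0 := by rw [rho_eq_one_sub (by norm_num)]; norm_num

/-- `ρ` is `C^∞`. [folklore] -/
theorem contDiff_rho : ContDiff ℝ ∞ rho :=
  (contDiff_phi.add (contDiff_phi.comp (contDiff_const.sub contDiff_id))).sub contDiff_const

/-- The derivative of `ρ` left of `7/10` is `φ'`. [folklore] -/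
theorem deriv_rho_of_lt {t : ℝ} (ht : t < 7 / 10) : deriv rho t = deriv phi t := by
  apply Filter.EventuallyEq.deriv_eq
  filter_upwards [Iio_mem_nhds ht] with s hs using rho_of_le (le_of_lt hs)

/-- The derivative of `ρ` right of `3/10` is `-φ' (1 - t)`. [folklore] -/
theorem deriv_rho_of_gt {t : ℝ} (ht : 3 / 10 < t) : deriv rho t = -deriv phi (1 - t) := by
  have e : deriv rho t = deriv (fun s ↦ phi (1 - s)) t := by
    apply Filter.EventuallyEq.deriv_eq
    filter_upwards [Ioi_mem_nhds ht] with s hs using rho_of_ge (le_of_lt hs)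
  rw [e]
  have h : HasDerivAt (fun s ↦ phi (1 - s)) (deriv phi (1 - t) * (0 - 1)) t :=
    ((contDiff_phi.differentiable (by simp)) (1 - t)).hasDerivAt.comp t
      ((hasDerivAt_const t (1:ℝ)).sub (hasDerivAt_id t))
  rw [h.deriv]; ring

/-- `ρ' > 0` on `(-∞, 3/10)`. [folklore] -/
theorem deriv_rho_pos {t : ℝ} (ht : t < 3 / 10) : 0 < deriv rho t := by
  rw [deriv_rho_of_lt (by linarith)]; exact deriv_phi_pos ht

/-- `ρ' < 0` on `(7/10, ∞)`. [folklore] -/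
theorem deriv_rho_neg {t : ℝ} (ht : 7 / 10 < t) : deriv rho t < 0 := by
  rw [deriv_rho_of_gt (by linarith), neg_lt_zero]; exact deriv_phi_pos (by linarith)

/-- `ρ' = 0` on the open plateau `(3/10, 7/10)`. [folklore] -/
theorem deriv_rho_plateau {t : ℝ} (h1 : 3 / 10 < t) (h2 : t < 7 / 10) : deriv rho t = 0 := by
  apply (Filter.EventuallyEq.deriv_eq (f := fun _ ↦ (3 / 10 : ℝ)) _).trans (deriv_const t _)
  filter_upwards [Ioo_mem_nhds h1 h2] with s hs using rho_eq_plateau hs.1.le hs.2.le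

/-- `ρ` is differentiable. [folklore] -/
theorem differentiable_rho : Differentiable ℝ rho := contDiff_rho.differentiable (by simp)

/-- `ρ` is strictly increasing on `(-∞, 3/10]`. [folklore] -/
theorem strictMonoOn_rho : StrictMonoOn rho (Iic (3 / 10)) :=
  strictMonoOn_of_deriv_pos (convex_Iic _) differentiable_rho.continuous.continuousOn fun t ht ↦
    deriv_rho_pos (by rwa [interior_Iic] at ht)

/-- `ρ` is strictly decreasing on `[7/10, ∞)`. [folklore] -/
theorem strictAntiOn_rho : StrictAntiOn rho (Ici (7 / 10)) :=
  strictAntiOn_of_deriv_neg (convex_Ici _) differentiable_rho.continuous.continuousOn fun t ht ↦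
    deriv_rho_neg (by rwa [interior_Ici] at ht)

/-- **The height of the arcs** `V = c ρ`. [folklore] -/
def V (t : ℝ) : ℝ := cc * rho t

/-- `V 0 = 0`. [folklore] -/
@[simp] theorem V_zero : V 0 = 0 := by simp [V]

/-- `V 1 = 0`. [folklore] -/
@[simp] theorem V_one : V 1 = 0 := by simp [V]

/-- `V t = c t` for `t ≤ 3/20`. [folklore] -/
theorem V_eq_mul {t : ℝ} (ht : t ≤ 3 / 20) : V t = cc * t := by rw [V, rho_eq_self ht]

/-- `V t = c (1 - t)` for `t ≥ 17/20`. [folklore] -/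
theorem V_eq_mul_one_sub {t : ℝ} (ht : 17 / 20 ≤ t) : V t = cc * (1 - t) := by rw [V, rho_eq_one_sub ht]

/-- `V = A` on the plateau `[3/10, 7/10]`. [folklore] -/
theorem V_eq_Aamp {t : ℝ} (h1 : 3 / 10 ≤ t) (h2 : t ≤ 7 / 10) : V t = Aamp := by
  rw [V, rho_eq_plateau h1 h2, cc_mul]

/-- `V ≤ A`. [folklore] -/
theorem V_le (t : ℝ) : V t ≤ Aamp := by
  rw [V, ← cc_mul]; exact mul_le_mul_of_nonneg_left (rho_le t) cc_pos.le

/-- `0 < V t` for `t ∈ (0, 1)`. [folklore] -/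
theorem V_pos {t : ℝ} (h0 : 0 < t) (h1 : t < 1) : 0 < V t := mul_pos cc_pos (rho_pos h0 h1)

/-- `V t < 0` for `t < 0`. [folklore] -/
theorem V_neg_of_neg {t : ℝ} (ht : t < 0) : V t < 0 := by
  rw [V_eq_mul (by linarith)]; exact mul_neg_of_pos_of_neg cc_pos ht

/-- `V t < 0` for `t > 1`. [folklore] -/
theorem V_neg_of_one_lt {t : ℝ} (ht : 1 < t) : V t < 0 := by
  rw [V_eq_mul_one_sub (by linarith)]; exact mul_neg_of_pos_of_neg cc_pos (by linarith)

/-- `V` is `C^∞`. [folklore] -/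
theorem contDiff_V : ContDiff ℝ ∞ V := contDiff_const.mul contDiff_rho

/-- `V` is differentiable. [folklore] -/
theorem differentiable_V : Differentiable ℝ V := contDiff_V.differentiable (by simp)

/-- The derivative of `V`. [folklore] -/
theorem deriv_V (t : ℝ) : deriv V t = cc * deriv rho t := by
  change deriv (fun s ↦ cc * rho s) t = _
  rw [deriv_const_mul _ (differentiable_rho t)]

/-- `V' > 0` on `(-∞, 3/10)`. [folklore] -/
theorem deriv_V_pos {t : ℝ} (ht : t < 3 / 10) : 0 < deriv V t := by
  rw [deriv_V]; exact mul_pos cc_pos (deriv_rho_pos ht)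

/-- `V' < 0` on `(7/10, ∞)`. [folklore] -/
theorem deriv_V_neg {t : ℝ} (ht : 7 / 10 < t) : deriv V t < 0 := by
  rw [deriv_V]; exact mul_neg_of_pos_of_neg cc_pos (deriv_rho_neg ht)

/-- `V' = 0` on `(3/10, 7/10)`. [folklore] -/
theorem deriv_V_plateau {t : ℝ} (h1 : 3 / 10 < t) (h2 : t < 7 / 10) : deriv V t = 0 := by
  rw [deriv_V, deriv_rho_plateau h1 h2, mul_zero]

/-- `V' = c` on `(-∞, 3/20)`. [folklore] -/
theorem deriv_V_of_lt {t : ℝ} (ht : t < 3 / 20) : deriv V t = cc := by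
  have e : deriv V t = deriv (fun s ↦ cc * s) t := by
    apply Filter.EventuallyEq.deriv_eq
    filter_upwards [Iio_mem_nhds ht] with s hs using V_eq_mul (le_of_lt hs)
  rw [e]
  have h : HasDerivAt (fun s ↦ cc * s) (cc * 1) t := (hasDerivAt_id t).const_mul cc
  rw [h.deriv, mul_one]

/-- `V' = -c` on `(17/20, ∞)`. [folklore] -/
theorem deriv_V_of_gt {t : ℝ} (ht : 17 / 20 < t) : deriv V t = -cc := by
  have e : deriv V t = deriv (fun s ↦ cc * (1 - s)) t := by
    apply Filter.EventuallyEq.deriv_eq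
    filter_upwards [Ioi_mem_nhds ht] with s hs using V_eq_mul_one_sub (le_of_lt hs)
  rw [e]
  have h : HasDerivAt (fun s ↦ cc * (1 - s)) (cc * (0 - 1)) t :=
    ((hasDerivAt_const t (1:ℝ)).sub (hasDerivAt_id t)).const_mul cc
  rw [h.deriv]; ring

/-- `V` is strictly increasing on `(-∞, 3/10]`. [folklore] -/
theorem strictMonoOn_V : StrictMonoOn V (Iic (3 / 10)) := fun _ ha _ hb h ↦
  mul_lt_mul_of_pos_left (strictMonoOn_rho ha hb h) cc_pos

/-- `V` is strictly decreasing on `[7/10, ∞)`. [folklore] -/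
theorem strictAntiOn_V : StrictAntiOn V (Ici (7 / 10)) := fun _ ha _ hb h ↦
  mul_lt_mul_of_pos_left (strictAntiOn_rho ha hb h) cc_pos

/-! ### The radial profile of the arcs -/

/-- **The radial profile** `X₀ = smoothStep (1/4) (3/4)`. [folklore] -/
def X0 (t : ℝ) : ℝ := smoothStep (1 / 4) (3 / 4) t

/-- `X₀ = 0` left of `1/4`. [folklore] -/
theorem X0_of_le {t : ℝ} (ht : t ≤ 1 / 4) : X0 t = 0 := smoothStep_of_le (by norm_num) ht

/-- `X₀ = 1` right of `3/4`. [folklore] -/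
theorem X0_of_ge {t : ℝ} (ht : 3 / 4 ≤ t) : X0 t = 1 := smoothStep_of_ge (by norm_num) ht

/-- `X₀ ∈ [0, 1]`. [folklore] -/
theorem X0_mem (t : ℝ) : X0 t ∈ Icc (0:ℝ) 1 := smoothStep_mem_Icc _ _ _

/-- `X₀ ∈ (0, 1)` on `(1/4, 3/4)`. [folklore] -/
theorem X0_mem_Ioo {t : ℝ} (ht : t ∈ Ioo (1 / 4 : ℝ) (3 / 4)) : X0 t ∈ Ioo (0:ℝ) 1 :=
  smoothStep_mem_Ioo (by norm_num) ht

/-- `X₀` is `C^∞`. [folklore] -/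
theorem contDiff_X0 : ContDiff ℝ ∞ X0 := contDiff_smoothStep _ _

/-- `X₀` is differentiable. [folklore] -/
theorem differentiable_X0 : Differentiable ℝ X0 := differentiable_smoothStep _ _

/-- `X₀' > 0` on `(1/4, 3/4)`. [folklore] -/
theorem deriv_X0_pos {t : ℝ} (ht : t ∈ Ioo (1 / 4 : ℝ) (3 / 4)) : 0 < deriv X0 t :=
  deriv_smoothStep_pos (by norm_num) ht

/-- `X₀' ≥ 0`. [folklore] -/
theorem deriv_X0_nonneg (t : ℝ) : 0 ≤ deriv X0 t := deriv_smoothStep_nonneg (by norm_num) t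

/-- `X₀' = 0` left of `1/4`. [folklore] -/
theorem deriv_X0_of_lt {t : ℝ} (ht : t < 1 / 4) : deriv X0 t = 0 := deriv_smoothStep_of_lt (by norm_num) ht

/-- `X₀' = 0` right of `3/4`. [folklore] -/
theorem deriv_X0_of_gt {t : ℝ} (ht : 3 / 4 < t) : deriv X0 t = 0 := deriv_smoothStep_of_gt (by norm_num) ht

/-- `X₀` is strictly increasing on `[1/4, 3/4]`. [folklore] -/
theorem strictMonoOn_X0 : StrictMonoOn X0 (Icc (1 / 4) (3 / 4)) := strictMonoOn_smoothStep (by norm_num)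

/-- `X₀` is monotone. [folklore] -/
theorem monotone_X0 : Monotone X0 := monotone_smoothStep (by norm_num)

/-- `X₀ t = 0 ↔ t ≤ 1/4`. [folklore] -/
theorem X0_eq_zero_iff {t : ℝ} : X0 t = 0 ↔ t ≤ 1 / 4 := by
  refine ⟨fun h ↦ ?_, X0_of_le⟩
  by_contra h'
  push Not at h'
  rcases lt_or_ge t (3 / 4) with h3 | h3
  · exact (X0_mem_Ioo ⟨h', h3⟩).1.ne' h
  · rw [X0_of_ge h3] at h; norm_num at h

/-- `X₀ t = 1 ↔ 3/4 ≤ t`. [folklore] -/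
theorem X0_eq_one_iff {t : ℝ} : X0 t = 1 ↔ 3 / 4 ≤ t := by
  refine ⟨fun h ↦ ?_, X0_of_ge⟩
  by_contra h'
  push Not at h'
  rcases le_or_gt t (1 / 4) with h3 | h3
  · rw [X0_of_le h3] at h; norm_num at h
  · exact (X0_mem_Ioo ⟨h3, h'⟩).2.ne h

/-- **The radial profile is tiny at `3/10`**: `X₀ (3/10) ≤ 1/40` (it is `smoothTransition (1/10) ≤ e^{-80/9}`).
[folklore] -/
theorem X0_three_tenths_le : X0 (3 / 10) ≤ 1 / 40 := by
  rw [X0, smoothStep]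
  have e : ((3 / 10 : ℝ) - 1 / 4) / (3 / 4 - 1 / 4) = 1 / 10 := by norm_num
  rw [e, Real.smoothTransition]
  have ha : expNegInvGlue (1 / 10 : ℝ) = Real.exp (-10) := by
    rw [expNegInvGlue, if_neg (by norm_num)]; norm_num
  have hb : expNegInvGlue (1 - 1 / 10 : ℝ) = Real.exp (-(10 / 9)) := by
    rw [expNegInvGlue, if_neg (by norm_num)]; norm_num
  rw [ha, hb, div_le_iff₀ (by positivity)]
  -- `40 e^{-10} ≤ e^{-10} + e^{-10/9}`, i.e. `39 ≤ e^{80/9}`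
  have h1 : Real.exp (-(10 / 9)) = Real.exp (-10) * Real.exp (80 / 9) := by
    rw [← Real.exp_add]; norm_num
  have h2 : (39 : ℝ) ≤ Real.exp (80 / 9) := by
    have := Real.quadratic_le_exp_of_nonneg (x := (80 / 9 : ℝ)) (by norm_num)
    nlinarith
  have h3 := Real.exp_pos (-10 : ℝ)
  nlinarith

/-- Symmetry of the radial profile: `X₀ (1 - t) = 1 - X₀ t`. [folklore] -/
theorem X0_one_sub (t : ℝ) : X0 (1 - t) = 1 - X0 t := by
  rw [X0, X0, smoothStep, smoothStep]
  have e1 : ((1 : ℝ) - t - 1 / 4) / (3 / 4 - 1 / 4) = 1 - (t - 1 / 4) / (3 / 4 - 1 / 4) := by ring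
  rw [e1]
  set x := (t - 1 / 4) / (3 / 4 - 1 / 4)
  rw [Real.smoothTransition, Real.smoothTransition, sub_sub_cancel, eq_sub_iff_add_eq, add_comm (expNegInvGlue (1 - x)),
    ← add_div, add_comm, div_self (Real.smoothTransition.pos_denom x).ne']

/-- `X₀ (7/10) ≥ 39/40`. [folklore] -/
theorem le_X0_seven_tenths : 39 / 40 ≤ X0 (7 / 10) := by
  have := X0_one_sub (3 / 10); norm_num at this; rw [this]; linarith [X0_three_tenths_le]

/-! ### The two arcs -/

/-- **The upper arc** from `(1, 11/10)` to `(0, 11/10)`: `t ↦ (1 - X₀ t, 11/10 - V t)`. [folklore] -/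
def upperArc (t : ℝ) : EuclideanSpace ℝ (Fin 2) := pt2 (1 - X0 t) (11 / 10 - V t)

/-- **The lower arc** from `(0, -1/10)` to `(1, -1/10)`: `t ↦ (X₀ t, -1/10 + V t)`. [folklore] -/
def lowerArc (t : ℝ) : EuclideanSpace ℝ (Fin 2) := pt2 (X0 t) (-(1 / 10) + V t)

/-- First coordinate of the upper arc. [folklore] -/
@[simp] theorem upperArc_apply_zero (t : ℝ) : upperArc t 0 = 1 - X0 t := rfl
/-- Second coordinate of the upper arc. [folklore] -/
@[simp] theorem upperArc_apply_one (t : ℝ) : upperArc t 1 = 11 / 10 - V t := rfl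
/-- First coordinate of the lower arc. [folklore] -/
@[simp] theorem lowerArc_apply_zero (t : ℝ) : lowerArc t 0 = X0 t := rfl
/-- Second coordinate of the lower arc. [folklore] -/
@[simp] theorem lowerArc_apply_one (t : ℝ) : lowerArc t 1 = -(1 / 10) + V t := rfl

/-- The upper arc is `C^∞`. [folklore] -/
theorem contDiff_upperArc : ContDiff ℝ ∞ upperArc := by
  unfold upperArc pt2
  exact contDiff_euclidean.2 fun i ↦ by
    fin_cases i
    · exact contDiff_const.sub contDiff_X0
    · exact contDiff_const.sub contDiff_V

/-- The lower arc is `C^∞`. [folklore] -/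
theorem contDiff_lowerArc : ContDiff ℝ ∞ lowerArc := by
  unfold lowerArc pt2
  exact contDiff_euclidean.2 fun i ↦ by
    fin_cases i
    · exact contDiff_X0
    · exact contDiff_const.add contDiff_V

/-- The lower arc starts at the lower-left corner `(0, -1/10)`. [folklore] -/
theorem lowerArc_zero : lowerArc 0 = pt2 0 (-(1 / 10)) := by
  rw [lowerArc, X0_of_le (by norm_num), V_zero, add_zero]

/-- The lower arc ends at the lower-right corner `(1, -1/10)`. [folklore] -/
theorem lowerArc_one : lowerArc 1 = pt2 1 (-(1 / 10)) := by
  rw [lowerArc, X0_of_ge (by norm_num), V_one, add_zero]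

/-- The upper arc starts at the upper-right corner `(1, 11/10)`. [folklore] -/
theorem upperArc_zero : upperArc 0 = pt2 1 (1 + 1 / 10) := by
  rw [upperArc, X0_of_le (by norm_num), V_zero]; norm_num

/-- The upper arc ends at the upper-left corner `(0, 11/10)`. [folklore] -/
theorem upperArc_one : upperArc 1 = pt2 0 (1 + 1 / 10) := by
  rw [upperArc, X0_of_ge (by norm_num), V_one]; norm_num

/-- The velocity of the lower arc. [folklore] -/
theorem hasDerivAt_lowerArc (t : ℝ) : HasDerivAt lowerArc (pt2 (deriv X0 t) (deriv V t)) t := by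
  unfold lowerArc
  have h := hasDerivAt_pt2 (differentiable_X0 t).hasDerivAt ((differentiable_V t).hasDerivAt.const_add (-(1 / 10)))
  exact h

/-- The velocity of the upper arc. [folklore] -/
theorem hasDerivAt_upperArc (t : ℝ) : HasDerivAt upperArc (pt2 (-deriv X0 t) (-deriv V t)) t := by
  unfold upperArc
  exact hasDerivAt_pt2 ((differentiable_X0 t).hasDerivAt.const_sub 1) ((differentiable_V t).hasDerivAt.const_sub _)

/-- **The arcs are regular**: at every `t ∈ (0, 1)` one of `X₀' t`, `V' t` is nonzero. [folklore] -/
theorem deriv_X0_V_ne_zero (t : ℝ) : deriv X0 t ≠ 0 ∨ deriv V t ≠ 0 := by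
  rcases lt_or_ge t (3 / 10) with h | h
  · exact Or.inr (deriv_V_pos h).ne'
  · rcases le_or_gt t (7 / 10) with h' | h'
    · exact Or.inl (deriv_X0_pos ⟨by linarith, by linarith⟩).ne'
    · exact Or.inr (deriv_V_neg h').ne

/-- The lower arc is regular. [folklore] -/
theorem deriv_lowerArc_ne_zero (t : ℝ) : deriv lowerArc t ≠ 0 := by
  rw [(hasDerivAt_lowerArc t).deriv]
  intro h
  have h0 := congrArg (fun z : EuclideanSpace ℝ (Fin 2) ↦ z 0) h
  have h1 := congrArg (fun z : EuclideanSpace ℝ (Fin 2) ↦ z 1) h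
  simp at h0 h1
  rcases deriv_X0_V_ne_zero t with h' | h'
  · exact h' h0
  · exact h' h1

/-- The upper arc is regular. [folklore] -/
theorem deriv_upperArc_ne_zero (t : ℝ) : deriv upperArc t ≠ 0 := by
  rw [(hasDerivAt_upperArc t).deriv]
  intro h
  have h0 := congrArg (fun z : EuclideanSpace ℝ (Fin 2) ↦ z 0) h
  have h1 := congrArg (fun z : EuclideanSpace ℝ (Fin 2) ↦ z 1) h
  simp at h0 h1
  rcases deriv_X0_V_ne_zero t with h' | h'
  · exact h' h0
  · exact h' h1

/-- **The arcs are embedded**: `X₀ s = X₀ t` and `V s = V t` with `s, t ∈ [0, 1]` force `s = t`. [folklore] -/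
theorem eq_of_X0_eq_of_V_eq {s t : ℝ} (hs : s ∈ Icc (0:ℝ) 1) (ht : t ∈ Icc (0:ℝ) 1) (hX : X0 s = X0 t)
    (hV : V s = V t) : s = t := by
  wlog hst : s ≤ t generalizing s t
  · exact (this ht hs hX.symm hV.symm (le_of_not_ge hst)).symm
  rcases hst.lt_or_eq with hlt | heq
  · exfalso
    -- where is `s`?
    rcases le_or_gt t (3 / 10) with h | h
    · exact (strictMonoOn_V (show s ∈ Iic (3/10) from (hlt.le.trans h)) h hlt).ne hV
    · rcases le_or_gt (7 / 10) s with h' | h'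
      · exact (strictAntiOn_V (show s ∈ Ici (7/10) from h') (show t ∈ Ici (7/10) from h'.trans hlt.le) hlt).ne' hV
      · -- `s < 7/10`, `t > 3/10`: compare the radial profile
        rcases lt_or_ge s (1 / 4) with hs4 | hs4
        · -- `X₀ s = 0`, so `X₀ t = 0`, `t ≤ 1/4 < 3/10 < t`
          have : X0 t = 0 := by rw [← hX, X0_of_le hs4.le]
          rw [X0_eq_zero_iff] at this; linarith
        · rcases lt_or_ge (3 / 4) t with ht4 | ht4
          · have : X0 s = 1 := by rw [hX, X0_of_ge ht4.le]
            rw [X0_eq_one_iff] at this; linarith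
          · exact (strictMonoOn_X0 ⟨hs4, by linarith⟩ ⟨by linarith, ht4⟩ hlt).ne hX
  · exact heq

/-- The lower arc is injective on `[0, 1]`. [folklore] -/
theorem injOn_lowerArc : InjOn lowerArc (Icc 0 1) := by
  intro s hs t ht h
  have h0 := congrArg (fun z : EuclideanSpace ℝ (Fin 2) ↦ z 0) h
  have h1 := congrArg (fun z : EuclideanSpace ℝ (Fin 2) ↦ z 1) h
  simp only [lowerArc_apply_zero, lowerArc_apply_one, add_right_inj] at h0 h1
  exact eq_of_X0_eq_of_V_eq hs ht h0 h1

/-- The upper arc is injective on `[0, 1]`. [folklore] -/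
theorem injOn_upperArc : InjOn upperArc (Icc 0 1) := by
  intro s hs t ht h
  have h0 := congrArg (fun z : EuclideanSpace ℝ (Fin 2) ↦ z 0) h
  have h1 := congrArg (fun z : EuclideanSpace ℝ (Fin 2) ↦ z 1) h
  simp only [upperArc_apply_zero, upperArc_apply_one, sub_right_inj] at h0 h1
  exact eq_of_X0_eq_of_V_eq hs ht h0 h1

/-- The lower arc lies in the lower half of the collar square `squareNhd (1/10)`. [folklore] -/
theorem lowerArc_mem {t : ℝ} (ht : t ∈ Ioo (0:ℝ) 1) : lowerArc t ∈ squareNhd (1 / 10) ∧ lowerArc t 1 < 2⁻¹ := by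
  have hV := V_pos ht.1 ht.2
  have hV' := V_le t
  have hA := Aamp_lt
  obtain ⟨h0, h1⟩ := X0_mem t
  refine ⟨fun i ↦ ?_, ?_⟩
  · fin_cases i
    · show X0 t ∈ Ioo (-(1/10)) (1 + 1/10); exact ⟨by linarith, by linarith⟩
    · show -(1/10) + V t ∈ Ioo (-(1/10)) (1 + 1/10); exact ⟨by linarith, by linarith⟩
  · show -(1/10) + V t < 2⁻¹; linarith

/-- The upper arc lies in the upper half of the collar square. [folklore] -/
theorem upperArc_mem {t : ℝ} (ht : t ∈ Ioo (0:ℝ) 1) : upperArc t ∈ squareNhd (1 / 10) ∧ 2⁻¹ < upperArc t 1 := by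
  have hV := V_pos ht.1 ht.2
  have hV' := V_le t
  have hA := Aamp_lt
  obtain ⟨h0, h1⟩ := X0_mem t
  refine ⟨fun i ↦ ?_, ?_⟩
  · fin_cases i
    · show 1 - X0 t ∈ Ioo (-(1/10)) (1 + 1/10); exact ⟨by linarith, by linarith⟩
    · show 11/10 - V t ∈ Ioo (-(1/10)) (1 + 1/10); exact ⟨by linarith, by linarith⟩
  · show 2⁻¹ < 11/10 - V t; linarith

end Polar

end BandSumUnit

end Literature.Topology.FourManifolds
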